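import Summits.QuantumFields.BalabanUV.Beta.D1BFx.SbRblkAnatomy
import Summits.QuantumFields.BalabanUV.Beta.D1BFx.GaugeJetWords
import Summits.QuantumFields.BalabanUV.Beta.D1BFx.FineStencilBFBalaban
import Summits.QuantumFields.BalabanUV.Beta.D1BFx.NeedleRowGlue

/-!
# `BalabanUV.Beta.D1BFx.GluonNeedleSplit` — road «BF-x» for binder row D1, slot (K), END row `hGrp gN` (NEEDLES ∪ G_R), «GN-SPLIT» of the owner's
# spec `GLUON-NEEDLE-ROWS.md` v0 §4: THE THREE PIECE FAMILIES OF `SbRblk` (projector jet, ghost-kinetic dipole, needle ⊗ column) AS KERNELS,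
# `SbRblk = cK • dip + ndl − proj`, THEIR LOCALISATION, THE BILINEAR SPLIT OF THE GLUON NEEDLE TABLES `S ⊗ SbRblk`, `SbRblk ⊗ T`, `SbRblk ⊗ SbRblk`
# INTO PIECE TABLES, AND THE PREFACTORS AT THE PINS (`cR = −cE` ⇒ `SbRc = cR • SbRblk`; `ωgl·cE² = 2N²n⁸`, `cE = n⁴` ⇒ `ωgl·cE·cR·n⁻⁸ = −2N²`, `ωgl·cR²·n⁻⁸ = 2N²`)

HONEST DEPENDENCY (cell records, verbatim): «continuum YM on T⁴ ⇐ BetaPertH ∧ nine spine estimates (0/9 proved); BetaPertH ⇐ (D1) ∧ (D4) ∧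
CAP+tail; G-an2-4 gates asym, D1 and NE2/3/4.»  HONEST FRAMING (cell contract, verbatim): «discharging `BetaPertH` makes Bałaban's UV stability
UNCONDITIONAL — a real constructive-QFT result; it is NOT the continuum limit and NOT the Clay problem.»  THIS MODULE DISCHARGES NOTHING of the wall:
THREE definitions with bodies ([our objects] the piece families `projPiece`, `dipPiece`, `ndlPiece` — names for sub-expressions of the tree's `SbRblk`,
so that the piece rows «GN-P», «GN-K», «GN-Q» can be stated) and [folklore] kernel algebra BY NAME: `GaugeJetLocal.SbRblk_apply` ∕ `SbRc_of_weights`,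
`RProjectorJet.Rdot_def` ∕ `rdotOf_def`, `CornerVBlockRank.cornerV_Sgh_apply`, the localisation sockets `RProjectorJet.biLoc_cornerV` ∕ `biLoc_cornerJ` ∕
`biLoc_Jq` ∕ `decays_Pgt`, `GhostStencil.biLoc_ghCur` ∕ `biLoc_qAnti`, `GhostLeg.decays_Ggh`, `RJetAssembly.biLoc_dSw` ∕ `biLoc_dJetSw_of_decays`,
`KernelWard.biLoc_add` ∕ `biLoc_sub`, `StepJetData.biLoc_smul`, `TameKernelCalculus.biLoc_trK` ∕ `bubble_add_left` ∕ `bubble_add_right`,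
`KernelWardRelative.bubble_sub_left`, `KernelReflection.bubble_smul_left` ∕ `bubble_smul_right`, `SectorRecut.exists_biLoc_SbT`, `GaugeJetWords.exists_biLoc_SbRblk`.
No `def … : Prop`, nothing cited, 0 sorry.  Asserts NO bound on any table; the pins `cR = −cE`, `cE = n⁴`, `ωgl·cE² = 2N²n⁸` are DISPLAYED hypotheses
(slot (K)'s sign condition ∕ ρ-g9-29 P3 ∕ the END's `hlam`), ruled nowhere here.  Root-level binders hW ∕ hR-sockets ∕ hSX-socket ∕ D1Tel ∕ D1Rep — 0
discharged; (K) NOT closed; NOT D1, NOT `BetaPertH`, NOT continuum, NOT Clay.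

ABSOLUTE RULE (cell charter, verbatim): «No internally-minted statement may enter as a cited fact. Every hypothesis is either kernel-proved in this
package or a verbatim quotation of a PUBLISHED theorem with page reference. The manuscript(s) under audit are NOT citable for their own disputed
steps — they are the thing under adjudication; programme-internal (2001/route/tribunal) claims are never citable.»

WHY (owner d1-p2-g9 `HOME/b2b-balaban-beta-d1-p2/GLUON-NEEDLE-ROWS.md` v0 548d2f974c4e0974: §1 «`SbRc = −n⁴ • SbRblk` … T₁ = −2N²·[SbT ⊗ SbRblk], T₂ likewise,
T₃ = +2N²·[SbRblk ⊗ SbRblk] — the explicit `n⁻⁸` is spent EXACTLY», §2 «`SbRblk κ u = dSw (Rdot κ u) − dJetSw κ u (Pgt)`, three pieces (P) projector jet,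
(K) dipole `cK·dSw (D − Dᵀ)`, (Q̇) needle ⊗ column», §4 «GN-SPLIT [folklore, S-sized, any A-node seat; FIRST]: … = (P-part) + cK·(K-part) + (Q̇-part) and
the 3 × 3 split of `SbRblk ⊗ SbRblk`, as table identities + the prefactor identities of §1»; journal MINE l.29665).  `Rdot = rdotOf (Ggh) (Pgt) (Sgh) (Jq)
= (cornerV Sgh − trK …) − (cornerJ Jq − trK …)` and `cornerV` is linear in the stencil (`cornerV_Sgh_apply`: `Sgh = cK·ghCur + cQ·qAnti`), so
`Rdot = cK • (cornerV ghCur − trK …) + (cQ • (cornerV qAnti − trK …) − (cornerJ Jq − trK …))` and `dSw` is linear: the split of §2 is an identity of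
kernels; every piece is bi-localised at its bond (so the bubble is additive in it against the spread leg `Ga`), whence the table splits.

CONTENT (block side `n` (`[NeZero n]`), weight `0 < a` where localisation is needed; `StencilR = Fin 4 → Site 4 → MKer 4 (Fin 4)`).
* §1 [our objects] `projPiece n a κ u := dJetSw κ u (Pgt n a)`, `dipPiece n a κ u := dSw (cornerV (Ggh n a) (Pgt n a) (ghCur κ u) − trK (…))`,
  `ndlPiece n a cQ κ u := dSw (cQ • (cornerV … (qAnti n κ u) − trK (…)) − (cornerJ … (Jq n a κ u) − trK (…)))`; [folklore] `dSw_add`, `dSw_sub`, `dSw_smul`,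
  **`Rdot_eq_pieces`**, **`SbRblk_eq_pieces`** (`SbRblk n a cK cQ κ u = cK • dipPiece n a κ u + ndlPiece n a cQ κ u − projPiece n a κ u`).
* §2 [folklore] localisation at the common rate `rate0 n a = δ_PP∕(4n)`: `decays_Ggh_rate0`, `biLoc_qAnti_rate0`, `biLoc_Jq_rate0`, `loc_projPiece`, `loc_dipPiece`,
  `loc_ndlPiece`, `loc_SbT`, `loc_SbRblk`.
* §3 [folklore] THE TABLE SPLITS over the spread gluon leg (`Spr (Ga n a)` — the END's `hGa`), for ANY bi-localised partner family: `bubble_sub_right`,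
  **`biBubbleTable_right_SbRblk_eq`** (`[S ⊗ SbRblk] = cK·[S ⊗ dip] + [S ⊗ ndl] − [S ⊗ proj]`), **`biBubbleTable_left_SbRblk_eq`** (mirror),
  **`biBubbleTable_SbRblk_SbRblk_eq`** (the nine words).
* §4 [folklore] THE PREFACTORS AT THE PINS: `biBubbleTable_right_SbRc_eq` ∕ `_left_` ∕ `biBubbleTable_SbRc_SbRc_eq` (`cR + cE = 0` ⇒ factors `cR`, `cR`, `cR²`),
  `omega_gl_eq_of_pins` (`ωgl = 2N²`), **`prefactor₁_eq`** (`ωgl·cE·cR·n⁻⁸ = −2N²`), **`prefactor₃_eq`** (`ωgl·(cR·cR)·n⁻⁸ = 2N²`).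
Unit `b2b-balaban-gan24-formalise-leaf-05` (gen 41), G-an2-4 swarm leaf prover on cross-lane kernel duty; `LEAVES-BFx.md` row (N) ∕ «GN-SPLIT».
-/

noncomputable section

namespace Summit.QuantumFields.BalabanUV.Beta.D1BFx.GluonNeedleSplit

open Finset
open scoped BigOperators
open Literature.MathematicalPhysics.QuantumFieldTheory.Balaban1983to89
open Literature.MathematicalPhysics.QuantumFieldTheory.Balaban1983to89.Beta
open B6QGQDecay237 (deltaU deltaU_pos)
open ExpKernelCalculus (Site MKer Decays BiLoc bubble)
open KernelWard (biLoc_add biLoc_sub)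
open StepJetData (biLoc_smul)
open KernelReflection (bubble_smul_left bubble_smul_right comp_smul_left comp_smul_right tr_smul)
open Summit.QuantumFields.BalabanUV.Beta.TameKernelCalculus (Spr Loc trK trK_apply biLoc_trK bubble_add_left bubble_add_right decays_of_le biLoc_of_le)
open Summit.QuantumFields.BalabanUV.Beta.KernelWardRelative (bubble_sub_left)
open Summit.QuantumFields.BalabanUV.Beta.D1BFx.ReducedKernel (StencilR)
open Summit.QuantumFields.BalabanUV.Beta.D1BFx.GluonLeg (Ga)
open Summit.QuantumFields.BalabanUV.Beta.D1BFx.GhostLeg (Ggh decays_Ggh const_nonneg)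
open Summit.QuantumFields.BalabanUV.Beta.D1BFx.GhostStencil (ghCur qAnti Sgh biLoc_ghCur biLoc_qAnti)
open Summit.QuantumFields.BalabanUV.Beta.D1BFx.RProjector (Pgt cPP deltaPP deltaPP_pos deltaP deltaP_pos)
open Summit.QuantumFields.BalabanUV.Beta.D1BFx.RJetAssembly (dSw dSw_apply dJetSw biLoc_dSw biLoc_dJetSw_of_decays)
open Summit.QuantumFields.BalabanUV.Beta.D1BFx.RProjectorJet (RG cornerV cornerJ rdotOf rdotOf_def Rdot Rdot_def Jq cJ dJ biLoc_cornerV biLoc_cornerJ biLoc_Jq)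
open Summit.QuantumFields.BalabanUV.Beta.D1BFx.RJetProjector (decays_Pgt)
open Summit.QuantumFields.BalabanUV.Beta.D1BFx.FineStencilBFBalaban (rate0 rate0_pos deltaPP_le)
open Summit.QuantumFields.BalabanUV.Beta.D1BFx.SectorRecut (SbT SbRc exists_biLoc_SbT)
open Summit.QuantumFields.BalabanUV.Beta.D1BFx.GaugeJetLocal (SbRblk SbRblk_apply SbRc_of_weights)
open Summit.QuantumFields.BalabanUV.Beta.D1BFx.GaugeJetWords (exists_biLoc_SbRblk)
open Summit.QuantumFields.BalabanUV.Beta.D1BFx.CornerVBlockRank (cornerV_Sgh_apply)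
open Summit.QuantumFields.BalabanUV.Beta.D1BFx.PackedKernelSplit (biBubble bubble_eq_biBubble)
open Summit.QuantumFields.BalabanUV.Beta.D1BFx.FineHessianSectors (biBubbleTable biBubbleTable_apply)

/-! ## §1 The three piece families of `SbRblk` and the kernel identity -/

/-- [our object] **THE PROJECTOR-JET PIECE FAMILY (P)**: `projPiece n a κ u := dJetSw κ u (Pgt n a)` — one slot pinned at the bond, the free slot a first
difference of a `Pgt` row.  A DEFINITION (a name for a sub-expression of `SbRblk`); asserts nothing. -/
def projPiece (n : ℕ) (a : ℝ) : StencilR := fun κ u => dJetSw κ u (Pgt n a)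

/-- [our object] **THE GHOST-KINETIC DIPOLE PIECE FAMILY (K)** (weight `cK` kept OUTSIDE): `dipPiece n a κ u := dSw (cornerV (Ggh n a) (Pgt n a) (ghCur κ u)
− trK (cornerV (Ggh n a) (Pgt n a) (ghCur κ u)))` — the antisymmetrised dipole `D − Dᵀ` of `CornerVBlockRank.Rdot_apply_road` under the two-slot difference `dSw`.
A DEFINITION; asserts nothing. -/
def dipPiece (n : ℕ) [NeZero n] (a : ℝ) : StencilR := fun κ u =>
  dSw (cornerV (Ggh n a) (Pgt n a) (ghCur κ u) - trK (cornerV (Ggh n a) (Pgt n a) (ghCur κ u)))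

/-- [our object] **THE NEEDLE ⊗ COLUMN PIECE FAMILY (Q̇)**: `ndlPiece n a cQ κ u := dSw (cQ • (cornerV (Ggh n a) (Pgt n a) (qAnti n κ u) − trK (…)) −
(cornerJ (Ggh n a) (Pgt n a) (Jq n a κ u) − trK (…)))` — the antisymmetrised `−row ⊗ C + C ⊗ row` of `Rdot_apply_road` under `dSw` (`cQ` lives inside the
combined column `C`).  A DEFINITION; asserts nothing. -/
def ndlPiece (n : ℕ) [NeZero n] (a cQ : ℝ) : StencilR := fun κ u =>
  dSw (cQ • (cornerV (Ggh n a) (Pgt n a) (qAnti n κ u) - trK (cornerV (Ggh n a) (Pgt n a) (qAnti n κ u)))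
    - (cornerJ (Ggh n a) (Pgt n a) (Jq n a κ u) - trK (cornerJ (Ggh n a) (Pgt n a) (Jq n a κ u))))

/-- [folklore] `dSw` is additive. -/
theorem dSw_add (Y₁ Y₂ : MKer 4 Unit) : dSw (Y₁ + Y₂) = dSw Y₁ + dSw Y₂ := by
  funext x z α β
  simp only [dSw_apply, Pi.add_apply]
  ring

/-- [folklore] `dSw` respects subtraction. -/
theorem dSw_sub (Y₁ Y₂ : MKer 4 Unit) : dSw (Y₁ - Y₂) = dSw Y₁ - dSw Y₂ := by
  funext x z α β
  simp only [dSw_apply, Pi.sub_apply]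
  ring

/-- [folklore] `dSw` is homogeneous. -/
theorem dSw_smul (c : ℝ) (Y : MKer 4 Unit) : dSw (c • Y) = c • dSw Y := by
  funext x z α β
  simp only [dSw_apply, Pi.smul_apply, smul_eq_mul]
  ring

variable (n : ℕ) [NeZero n] (a cE cR cK cQ : ℝ) (κ : Fin 4) (u : Site 4)

omit [NeZero n] in
/-- [our object] Unfolding `projPiece`. -/
theorem projPiece_apply : projPiece n a κ u = dJetSw κ u (Pgt n a) := rfl

/-- [our object] Unfolding `dipPiece`. -/
theorem dipPiece_apply : dipPiece n a κ u = dSw (cornerV (Ggh n a) (Pgt n a) (ghCur κ u) - trK (cornerV (Ggh n a) (Pgt n a) (ghCur κ u))) := rfl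

/-- [our object] Unfolding `ndlPiece`. -/
theorem ndlPiece_apply : ndlPiece n a cQ κ u =
    dSw (cQ • (cornerV (Ggh n a) (Pgt n a) (qAnti n κ u) - trK (cornerV (Ggh n a) (Pgt n a) (qAnti n κ u)))
      - (cornerJ (Ggh n a) (Pgt n a) (Jq n a κ u) - trK (cornerJ (Ggh n a) (Pgt n a) (Jq n a κ u)))) := rfl

/-- [folklore] **THE STRIPPED PROJECTOR JET AS A SUM OF KERNELS**: `Rdot n a cK cQ κ u = cK • (cornerV ghCur − trK …) + (cQ • (cornerV qAnti − trK …) −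
(cornerJ Jq − trK …))` (`Rdot_def`, `rdotOf_def`, linearity of `cornerV` in the stencil `CornerVBlockRank.cornerV_Sgh_apply`). -/
theorem Rdot_eq_pieces : Rdot n a cK cQ κ u =
    cK • (cornerV (Ggh n a) (Pgt n a) (ghCur κ u) - trK (cornerV (Ggh n a) (Pgt n a) (ghCur κ u)))
      + (cQ • (cornerV (Ggh n a) (Pgt n a) (qAnti n κ u) - trK (cornerV (Ggh n a) (Pgt n a) (qAnti n κ u)))
          - (cornerJ (Ggh n a) (Pgt n a) (Jq n a κ u) - trK (cornerJ (Ggh n a) (Pgt n a) (Jq n a κ u)))) := by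
  funext x q v w
  rw [Rdot_def, rdotOf_def]
  simp only [Pi.add_apply, Pi.sub_apply, Pi.smul_apply, smul_eq_mul, trK_apply, cornerV_Sgh_apply]
  ring

/-- [folklore] **«GN-SPLIT» AT THE KERNEL LEVEL**: `SbRblk n a cK cQ κ u = cK • dipPiece n a κ u + ndlPiece n a cQ κ u − projPiece n a κ u`. -/
theorem SbRblk_eq_pieces : SbRblk n a cK cQ κ u = cK • dipPiece n a κ u + ndlPiece n a cQ κ u - projPiece n a κ u := by
  rw [SbRblk_apply, Rdot_eq_pieces, dSw_add, dSw_smul]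
  rfl

/-! ## §2 Localisation of the pieces at their bond (common rate `rate0 n a`) -/

/-- [folklore] The ghost leg decays at the weakened rate `rate0 n a` (as in `FineStencilBFBalaban.biLoc_Rdot_bal`). -/
theorem decays_Ggh_rate0 (ha : 0 < a) : Decays (Ggh n a) (2 / min 2 a) (rate0 n a) := by
  have hn : (0 : ℝ) < n := Nat.cast_pos.mpr (Nat.pos_of_ne_zero (NeZero.ne n))
  obtain ⟨hu, _⟩ := deltaPP_le a
  have hδu := deltaU_pos 4 ha
  have h := decays_of_le (decays_Ggh n a ha) (show rate0 n a ≤ deltaU 4 a / (4 * n) by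
    unfold rate0; exact div_le_div_of_nonneg_right (by linarith) (by positivity))
  rwa [abs_of_nonneg (const_nonneg a ha)] at h

/-- [folklore] The stripped averaging jet is bi-localised at the rate `rate0 n a` (`biLoc_qAnti` at `δ := δ_PP∕4`). -/
theorem biLoc_qAnti_rate0 (ha : 0 < a) : BiLoc (qAnti n κ u) u u (8 / (n : ℝ) ^ 3 * Real.exp (8 * (deltaPP 4 a / 4))) (rate0 n a) := by
  have h := biLoc_qAnti κ u n (show (0 : ℝ) ≤ deltaPP 4 a / 4 by have := deltaPP_pos 4 ha; positivity)
  have e : deltaPP 4 a / 4 / (n : ℝ) = rate0 n a := by unfold rate0; field_simp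
  rwa [e] at h

/-- [folklore] The `Q̇`-corner stencil `Jq` is bi-localised at the rate `rate0 n a` (weakened from `dJ a ∕ n`). -/
theorem biLoc_Jq_rate0 (ha : 0 < a) : BiLoc (Jq n a κ u) u u (|cJ n a|) (rate0 n a) := by
  have hn : (0 : ℝ) < n := Nat.cast_pos.mpr (Nat.pos_of_ne_zero (NeZero.ne n))
  obtain ⟨_, hp⟩ := deltaPP_le a
  have hδP := deltaP_pos 4 ha
  refine biLoc_of_le (biLoc_Jq n a κ u ha) ?_
  unfold rate0 dJ
  rw [div_div]
  exact div_le_div_of_nonneg_right (by linarith) (by positivity)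

/-- [folklore] **THE PROJECTOR-JET PIECE IS LOCALISED** (`biLoc_dJetSw_of_decays` + `decays_Pgt`). -/
theorem loc_projPiece (ha : 0 < a) : Loc (projPiece n a κ u) :=
  ⟨u, u, _, rate0 n a, rate0_pos n a ha, biLoc_dJetSw_of_decays κ u (rate0_pos n a ha).le (decays_Pgt n a ha)⟩

/-- [folklore] **THE DIPOLE PIECE IS LOCALISED** (`biLoc_cornerV` with `biLoc_ghCur`, `biLoc_trK`, `biLoc_sub`, `biLoc_dSw`). -/
theorem loc_dipPiece (ha : 0 < a) : Loc (dipPiece n a κ u) := by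
  have h0 := rate0_pos n a ha
  have hc := biLoc_cornerV (decays_Ggh_rate0 n a ha) (decays_Pgt n a ha) (biLoc_ghCur κ u (rate0 n a)) h0
  have h := biLoc_sub hc (biLoc_trK hc)
  exact ⟨u, u, _, _, by positivity, biLoc_dSw u _ (by positivity) h⟩

/-- [folklore] **THE NEEDLE ⊗ COLUMN PIECE IS LOCALISED** (`biLoc_cornerV` at `qAnti`, `biLoc_cornerJ` at `Jq`, `biLoc_smul`, `biLoc_trK`, `biLoc_sub`, `biLoc_dSw`). -/
theorem loc_ndlPiece (ha : 0 < a) : Loc (ndlPiece n a cQ κ u) := by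
  have h0 := rate0_pos n a ha
  have hV := biLoc_cornerV (decays_Ggh_rate0 n a ha) (decays_Pgt n a ha) (biLoc_qAnti_rate0 n a κ u ha) h0
  have hJ := biLoc_cornerJ (decays_Ggh_rate0 n a ha) (decays_Pgt n a ha) (biLoc_Jq_rate0 n a κ u ha) h0
  have h := biLoc_sub (biLoc_smul (biLoc_sub hV (biLoc_trK hV)) cQ) (biLoc_sub hJ (biLoc_trK hJ))
  exact ⟨u, u, _, _, by positivity, biLoc_dSw u _ (by positivity) h⟩

omit [NeZero n] in
/-- [folklore] The transverse bordering stencil is localised (`SectorRecut.exists_biLoc_SbT`). -/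
theorem loc_SbT : Loc (SbT κ u) := by
  obtain ⟨Cs, δs, hδs, h⟩ := exists_biLoc_SbT
  exact ⟨u, u, Cs, δs, hδs, h κ u⟩

/-- [folklore] `SbRblk` is localised (`GaugeJetWords.exists_biLoc_SbRblk`). -/
theorem loc_SbRblk (ha : 0 < a) : Loc (SbRblk n a cK cQ κ u) := by
  obtain ⟨Cs, δs, hδs, h⟩ := exists_biLoc_SbRblk n a cK cQ ha
  exact ⟨u, u, Cs, δs, hδs, h κ u⟩

/-! ## §3 The bilinear split of the gluon needle tables -/

/-- [folklore] Subtraction in the second vertex of the bubble (from `bubble_add_right`). -/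
theorem bubble_sub_right {F : Type*} [Fintype F] {A Y Z₁ Z₂ : MKer 4 F} (hA : Spr A) (hY : Loc Y) (h₁ : Loc Z₁) (h₂ : Loc Z₂) :
    bubble A Y (Z₁ - Z₂) = bubble A Y Z₁ - bubble A Y Z₂ := by
  have h := bubble_add_right hA hY (h₁.sub h₂) h₂
  rw [sub_add_cancel] at h
  linarith

variable {S T : StencilR} (lam : Fin 4) (p : Site 4)

/-- [folklore] **«GN-SPLIT», RIGHT SLOT**: for the spread gluon leg and ANY localised partner family `S`,
`biBubbleTable (Ga)(Ga) S SbRblk κ λ p u = cK·[S ⊗ dipPiece] + [S ⊗ ndlPiece] − [S ⊗ projPiece]` (same indices). -/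
theorem biBubbleTable_right_SbRblk_eq (hGa : Spr (Ga n a)) (ha : 0 < a) (hS : ∀ κ u, Loc (S κ u)) :
    biBubbleTable (Ga n a) (Ga n a) S (SbRblk n a cK cQ) κ lam p u =
      cK * biBubbleTable (Ga n a) (Ga n a) S (dipPiece n a) κ lam p u
        + biBubbleTable (Ga n a) (Ga n a) S (ndlPiece n a cQ) κ lam p u
        - biBubbleTable (Ga n a) (Ga n a) S (projPiece n a) κ lam p u := by
  simp only [biBubbleTable_apply, ← bubble_eq_biBubble]
  rw [SbRblk_eq_pieces,
    bubble_sub_right hGa (hS κ p) (((loc_dipPiece n a lam u ha).smul cK).add (loc_ndlPiece n a cQ lam u ha)) (loc_projPiece n a lam u ha),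
    bubble_add_right hGa (hS κ p) ((loc_dipPiece n a lam u ha).smul cK) (loc_ndlPiece n a cQ lam u ha), bubble_smul_right]
  simp only [dipPiece, ndlPiece, projPiece]
  ring

/-- [folklore] **«GN-SPLIT», LEFT SLOT**: for ANY localised partner family `T`,
`biBubbleTable (Ga)(Ga) SbRblk T κ λ p u = cK·[dipPiece ⊗ T] + [ndlPiece ⊗ T] − [projPiece ⊗ T]`. -/
theorem biBubbleTable_left_SbRblk_eq (hGa : Spr (Ga n a)) (ha : 0 < a) (hT : ∀ κ u, Loc (T κ u)) :
    biBubbleTable (Ga n a) (Ga n a) (SbRblk n a cK cQ) T κ lam p u =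
      cK * biBubbleTable (Ga n a) (Ga n a) (dipPiece n a) T κ lam p u
        + biBubbleTable (Ga n a) (Ga n a) (ndlPiece n a cQ) T κ lam p u
        - biBubbleTable (Ga n a) (Ga n a) (projPiece n a) T κ lam p u := by
  simp only [biBubbleTable_apply, ← bubble_eq_biBubble]
  rw [SbRblk_eq_pieces,
    bubble_sub_left hGa (((loc_dipPiece n a κ p ha).smul cK).add (loc_ndlPiece n a cQ κ p ha)) (loc_projPiece n a κ p ha) (hT lam u),
    bubble_add_left hGa ((loc_dipPiece n a κ p ha).smul cK) (loc_ndlPiece n a cQ κ p ha) (hT lam u), bubble_smul_left]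
  simp only [dipPiece, ndlPiece, projPiece]
  ring

/-- [folklore] **«GN-SPLIT», BOTH SLOTS — THE NINE WORDS OF `SbRblk ⊗ SbRblk`** (weights `cK²`, `cK`, `−cK`, `cK`, `1`, `−1`, `−cK`, `−1`, `1`). -/
theorem biBubbleTable_SbRblk_SbRblk_eq (hGa : Spr (Ga n a)) (ha : 0 < a) :
    biBubbleTable (Ga n a) (Ga n a) (SbRblk n a cK cQ) (SbRblk n a cK cQ) κ lam p u =
      cK * (cK * biBubbleTable (Ga n a) (Ga n a) (dipPiece n a) (dipPiece n a) κ lam p u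
          + biBubbleTable (Ga n a) (Ga n a) (dipPiece n a) (ndlPiece n a cQ) κ lam p u
          - biBubbleTable (Ga n a) (Ga n a) (dipPiece n a) (projPiece n a) κ lam p u)
      + (cK * biBubbleTable (Ga n a) (Ga n a) (ndlPiece n a cQ) (dipPiece n a) κ lam p u
          + biBubbleTable (Ga n a) (Ga n a) (ndlPiece n a cQ) (ndlPiece n a cQ) κ lam p u
          - biBubbleTable (Ga n a) (Ga n a) (ndlPiece n a cQ) (projPiece n a) κ lam p u)
      - (cK * biBubbleTable (Ga n a) (Ga n a) (projPiece n a) (dipPiece n a) κ lam p u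
          + biBubbleTable (Ga n a) (Ga n a) (projPiece n a) (ndlPiece n a cQ) κ lam p u
          - biBubbleTable (Ga n a) (Ga n a) (projPiece n a) (projPiece n a) κ lam p u) := by
  rw [biBubbleTable_left_SbRblk_eq n a cK cQ κ u lam p hGa ha (fun l v => loc_SbRblk n a cK cQ l v ha),
    biBubbleTable_right_SbRblk_eq n a cK cQ κ u lam p hGa ha (fun l v => loc_dipPiece n a l v ha),
    biBubbleTable_right_SbRblk_eq n a cK cQ κ u lam p hGa ha (fun l v => loc_ndlPiece n a cQ l v ha),
    biBubbleTable_right_SbRblk_eq n a cK cQ κ u lam p hGa ha (fun l v => loc_projPiece n a l v ha)]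

/-! ## §4 The prefactors at the pins -/

/-- [folklore] **ON THE FEYNMAN HYPERPLANE `cR + cE = 0` THE RE-CUT R-SECTOR IS `cR • SbRblk`**, right slot: `[S ⊗ SbRc] = cR·[S ⊗ SbRblk]` (no hypothesis on the
legs or partners: `bubble_smul_right` is unconditional). -/
theorem biBubbleTable_right_SbRc_eq (A B : MKer 4 (Fin 4)) (S' : StencilR) (h : cR + cE = 0) :
    biBubbleTable A B S' (SbRc n a cE cR cK cQ) κ lam p u = cR * biBubbleTable A B S' (SbRblk n a cK cQ) κ lam p u := by
  rw [biBubbleTable_apply, biBubbleTable_apply, SbRc_of_weights lam u n a cE cR cK cQ h]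
  unfold biBubble
  rw [comp_smul_right, comp_smul_right, tr_smul]
  ring

/-- [folklore] … left slot: `[SbRc ⊗ T] = cR·[SbRblk ⊗ T]`. -/
theorem biBubbleTable_left_SbRc_eq (A B : MKer 4 (Fin 4)) (T' : StencilR) (h : cR + cE = 0) :
    biBubbleTable A B (SbRc n a cE cR cK cQ) T' κ lam p u = cR * biBubbleTable A B (SbRblk n a cK cQ) T' κ lam p u := by
  rw [biBubbleTable_apply, biBubbleTable_apply, SbRc_of_weights κ p n a cE cR cK cQ h]
  unfold biBubble
  rw [comp_smul_right, KernelReflection.comp_smul_left, tr_smul]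
  ring

/-- [folklore] … both slots: `[SbRc ⊗ SbRc] = cR²·[SbRblk ⊗ SbRblk]`. -/
theorem biBubbleTable_SbRc_SbRc_eq (A B : MKer 4 (Fin 4)) (h : cR + cE = 0) :
    biBubbleTable A B (SbRc n a cE cR cK cQ) (SbRc n a cE cR cK cQ) κ lam p u =
      cR * cR * biBubbleTable A B (SbRblk n a cK cQ) (SbRblk n a cK cQ) κ lam p u := by
  rw [biBubbleTable_left_SbRc_eq n a cE cR cK cQ κ u lam p A B _ h, biBubbleTable_right_SbRc_eq n a cE cR cK cQ κ u lam p A B _ h]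
  ring

variable {ωgl N : ℝ}

/-- [folklore] **THE GLUON LOOP WEIGHT AT THE PINS**: `ωgl·cE² = 2N²n⁸` (the END's `hlam`) and `cE = n⁴` (ρ-g9-29 P3) give `ωgl = 2N²`. -/
theorem omega_gl_eq_of_pins (hlam : ωgl * cE ^ 2 = 2 * N ^ 2 * (n : ℝ) ^ 8) (hcE : cE = (n : ℝ) ^ 4) : ωgl = 2 * N ^ 2 := by
  have hn : (0 : ℝ) < n := Nat.cast_pos.mpr (Nat.pos_of_ne_zero (NeZero.ne n))
  have h8 : (0 : ℝ) < (n : ℝ) ^ 8 := pow_pos hn 8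
  rw [hcE] at hlam
  have e : ωgl * ((n : ℝ) ^ 4) ^ 2 = ωgl * (n : ℝ) ^ 8 := by ring
  rw [e] at hlam
  exact mul_right_cancel₀ h8.ne' hlam

/-- [folklore] **THE PREFACTOR OF T₁ ∕ T₂**: `ωgl·cE·cR·n⁻⁸ = −2N²` at the pins `hlam`, `cE = n⁴`, `cR = −cE`. -/
theorem prefactor₁_eq (hlam : ωgl * cE ^ 2 = 2 * N ^ 2 * (n : ℝ) ^ 8) (hcE : cE = (n : ℝ) ^ 4) (hR : cR = -cE) :
    ωgl * cE * cR * ((n : ℝ) ^ 8)⁻¹ = -(2 * N ^ 2) := by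
  have hn : (0 : ℝ) < n := Nat.cast_pos.mpr (Nat.pos_of_ne_zero (NeZero.ne n))
  have h8 : (n : ℝ) ^ 8 ≠ 0 := (pow_pos hn 8).ne'
  rw [omega_gl_eq_of_pins n cE hlam hcE, hR, hcE]
  field_simp

/-- [folklore] **THE PREFACTOR OF T₃**: `ωgl·(cR·cR)·n⁻⁸ = 2N²` at the same pins. -/
theorem prefactor₃_eq (hlam : ωgl * cE ^ 2 = 2 * N ^ 2 * (n : ℝ) ^ 8) (hcE : cE = (n : ℝ) ^ 4) (hR : cR = -cE) :
    ωgl * (cR * cR) * ((n : ℝ) ^ 8)⁻¹ = 2 * N ^ 2 := by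
  have hn : (0 : ℝ) < n := Nat.cast_pos.mpr (Nat.pos_of_ne_zero (NeZero.ne n))
  have h8 : (n : ℝ) ^ 8 ≠ 0 := (pow_pos hn 8).ne'
  rw [omega_gl_eq_of_pins n cE hlam hcE, hR, hcE]
  field_simp

end Summit.QuantumFields.BalabanUV.Beta.D1BFx.GluonNeedleSplit

end
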